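import Summits.AtomisticToContinuum.HydrodynamicLimit.Theorems.EnskogAdjointDualityCollisionResidualVanishesCutoffAssembly
import Summits.AtomisticToContinuum.HydrodynamicLimit.Theorems.EnskogAdjointDualityCollisionResidualVanishesCutoffFSide
import Summits.AtomisticToContinuum.HydrodynamicLimit.Theorems.EnskogAdjointDualityCollisionResidualVanishesHydroAtTime
import Summits.AtomisticToContinuum.HydrodynamicLimit.Theorems.EnskogAdjointDualityDualityReductionInitial
import Summits.AtomisticToContinuum.HydrodynamicLimit.Theorems.EnskogAdjointDualityDualityReductionLBound
import Summits.AtomisticToContinuum.HydrodynamicLimit.Theorems.EnskogAdjointDualityDualityReductionLMeasurable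
import Summits.AtomisticToContinuum.HydrodynamicLimit.Theorems.EnskogAdjointDualityDualityReductionFSide
import Summits.AtomisticToContinuum.HydrodynamicLimit.Theorems.EnskogAdjointDualityDualityReductionProfiles
import Summits.AtomisticToContinuum.HydrodynamicLimit.Theorems.EnskogAdjointDualityDualityReductionCZero
import HarnessLib

/-!
# EnskogAdjointDuality / CollisionResidualVanishes — the converse duality theorem under a velocity cutoff
# (cutoff toolkit T5)

Support theorem for the crux `Summit.AtomisticToContinuum.HydrodynamicLimit.Theses.EnskogAdjointDuality.CollisionResidualVanishes`
(K1, stmt-AtomisticToContinuum-14658, line `birth`, lead c6). The landed converse duality theorem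
`collisionResidual_tendsto_zero_of_tendstoHydroFieldsAt` (lead c3) says: on every admissible test
family with the properties (i)–(v) of the sibling crux `AdjointEnskogTestFamilyR` (K2R), the
hydrodynamic limit AT TIME `t` implies that K1's collision residual vanishes in mean square. K2R was
found false AS TYPED by its line lead (2026-08-17, `Cruxes/AdjointEnskogTestFamilyR/HyperVelocityObstruction.md`):
property (iii), the defect bound `|Dφ^N + L^Nφ^N| ≤ η_N(1+|v|²)` for ALL `v ∈ ℝ³`, is unsatisfiable
in the admissible class (isotropic log cascade at hyper-velocities), so the landed converse theorem
has (at every non-trivial datum) no family to apply to. The proposed repair of K2R asks (iii) only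
for `‖v‖ ≤ N + 1` plus a crude global polynomial bound `|Dφ^N + L^Nφ^N| ≤ C_g(1+|v|²)³`. This file
proves the converse duality theorem under exactly these CUTOFF premises, with the same conclusion;
it is the certificate that a K1 restated to the cutoff-dual families stays conjunct-grade (no easier
than the hydrodynamic limit at time `t`). Ingredients: the cutoff `L²` assembly
`residual_assembly_cut` (energy event + Markov weight, toolkit T4) and the cutoff Euler-side bound
`abs_I3_add_half_I2_le_cut` (Gaussian tail above the cutoff, toolkit T3).

* `collisionResidual_tendsto_zero_of_tendstoHydroFieldsAt_cut` — the statement;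
  `cutoff_converse_duality` — its registered closed form.

References: M. Pulvirenti, S. Simonella, arXiv:1504.03215, §2 [PulvirentiSimonella2016];
T. Bodineau, I. Gallagher, L. Saint-Raymond, Ann. PDE 3 (2017) [BGSR2017]; H. Spohn (1991),
Part I Ch. 3 [Spohn1991].
-/

noncomputable section

open MeasureTheory Set Filter Topology Function
open scoped ENNReal BigOperators InnerProductSpace

namespace Summit.AtomisticToContinuum.HydrodynamicLimit.Theorems

open Literature.Analysis.FluidPDE Literature.MathematicalPhysics.KineticTheory
  Literature.Analysis.FunctionSpaces
open Literature.MathematicalPhysics.QuantumLattice (clamp_mem_Icc clamp_eq_self)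

variable {a₀ θ₀ : T3 → ℝ} {u₀ : T3 → V3}

/-- **Converse duality: the hydrodynamic limit at time `t` implies that the collision residual
vanishes on every approximately-dual test family.** Fix an EOS window `(0, η₁)` on which
`f_ex = hsExcessFreeEnergy` is analytic, continuous positive profiles, `0 < σ ≤ 1/2`, a classical
hs-Euler solution `(ρ, u, θ)` on `[0, T)` whose local Gibbs data satisfy the `t = 0` law of large
numbers, hard-sphere flows `Φ N`, a time `t ∈ (0, T)` with packing `ρ_sσ³ < η₁` on `[0, t]`, and an
ADMISSIBLE test family `φ^N = c^N·(1, v, |v|²/2) + κ^N/λ_N` with the properties (i)–(v) of the crux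
`AdjointEnskogTestFamilyR` at `(t, χ, a, b, e)` (terminal data `χ(a + b·v + e|v|²/2)`; `C¹` along
free flight and defect `|Dφ^N + L^Nφ^N| ≤ η_N(1+|v|²)` on `[0,t]` FOR `‖v‖ ≤ N + 1` eventually, `η_N → 0`,
together with a global polynomial bound `|Dφ^N + L^Nφ^N| ≤ C_g(1+|v|²)³` (the velocity-cutoff repair of
K2R's (iii) after its refutation as typed, 2026-08-17);
`c^N(0,·) → c₀` uniformly; Enskog defect `Res_N → 0`). IF the three empirical fields at time `t`
converge in probability to `(ρ, ρu, E)(t)` (`TendstoHydroFieldsAt … t` — the conclusion of the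
conjunct `HydrodynamicLimit` at `t`), THEN the collision residual of the crux
`CollisionResidualVanishes` at this family tends to `0` in mean square:
`∫⁻ 𝓡_N[φ^N]² d(localGibbsLaw) → 0` (the `let`s `G ε lam f Y φ L R` are verbatim those of the route
decl). With the forward glue (`duality_assembly` / the route's `closes`) this says: on the
approximately-dual families the assembly uses, K1 is EQUIVALENT to the mean-square hydrodynamic
limit at time `t`; in particular the conjunct itself implies K1 there.
[cite: PulvirentiSimonella2016, §2] -/
theorem collisionResidual_tendsto_zero_of_tendstoHydroFieldsAt_cut {η₁ : ℝ}
    (hA : AnalyticOnNhd ℝ hsExcessFreeEnergy (Set.Ioo 0 η₁))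
    (ha : Continuous a₀) (hθ : Continuous θ₀) (hu : Continuous u₀)
    (ha0 : ∀ x, 0 < a₀ x) (hθ0 : ∀ x, 0 < θ₀ x) {σ : ℝ} (hσ : 0 < σ) (hσhalf : σ ≤ 1 / 2)
    {T : ℝ} {ρ θ : ℝ → UnitAddTorus (Fin 3) → ℝ} {u : ℝ → UnitAddTorus (Fin 3) → EuclideanSpace ℝ (Fin 3)}
    (hEul : IsHardSphereEulerSolution σ T ρ u θ)
    (Φ : (N : ℕ) → HardSphereFlow (Torus.geometry (Fin 3)) (hsDiameter σ N) (N + 1))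
    (hLLN : TendstoHydroFieldsAt (fun N => localGibbsLaw σ a₀ u₀ θ₀ N (Φ N)) Φ ρ u θ 0)
    {t : ℝ} (ht : t ∈ Set.Ioo 0 T) (hguard : ∀ s ∈ Set.Icc 0 t, ∀ x, ρ s x * σ ^ 3 < η₁)
    (hHyd : TendstoHydroFieldsAt (fun N => localGibbsLaw σ a₀ u₀ θ₀ N (Φ N)) Φ ρ u θ t)
    {χ : UnitAddTorus (Fin 3) → ℝ} (hχ : Continuous χ) (a e : ℝ) (b : EuclideanSpace ℝ (Fin 3))
    (c : ℕ → ℝ → UnitAddTorus (Fin 3) → ℝ × EuclideanSpace ℝ (Fin 3) × ℝ)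
    (κ : ℕ → ℝ → UnitAddTorus (Fin 3) → EuclideanSpace ℝ (Fin 3) → ℝ)
    (hc : ∀ N, Continuous (Function.uncurry (c N)))
    (hκ : ∀ N, Continuous (fun p : ℝ × UnitAddTorus (Fin 3) × EuclideanSpace ℝ (Fin 3) =>
      κ N p.1 p.2.1 p.2.2))
    (hadm : ∃ C : ℝ, ∀ N s x x' v v', ‖c N s x‖ ≤ C ∧ dist (c N s x) (c N s x') ≤ C * dist x x' ∧
      |κ N s x v| ≤ C * (1 + ‖v‖ ^ 2) ∧
      |κ N s x v - κ N s x' v'| ≤ C * (1 + ‖v‖ ^ 2 + ‖v'‖ ^ 2) * (dist x x' + ‖v - v'‖)) :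
    let G := Literature.Analysis.FluidPDE.Torus.geometry (Fin 3)
    let ε := fun N : ℕ => Literature.MathematicalPhysics.KineticTheory.hsDiameter σ N
    let lam := fun N : ℕ => (N : ℝ) * ε N ^ 2
    let f := fun (s : ℝ) (x : UnitAddTorus (Fin 3)) (v : EuclideanSpace ℝ (Fin 3)) =>
      ρ s x * Literature.Analysis.FluidPDE.localMaxwellian 1 (θ s x) (u s x) v
    let Y := fun η : ℝ => 3 / (2 * Real.pi) * deriv Literature.MathematicalPhysics.KineticTheory.hsExcessFreeEnergy η
    let φ := fun (N : ℕ) (s : ℝ) (x : UnitAddTorus (Fin 3)) (v : EuclideanSpace ℝ (Fin 3)) =>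
      (c N s x).1 + inner ℝ (c N s x).2.1 v + (c N s x).2.2 * ‖v‖ ^ 2 / 2 + (lam N)⁻¹ * κ N s x v
    let L := fun (N : ℕ) (s : ℝ) (x : UnitAddTorus (Fin 3)) (v : EuclideanSpace ℝ (Fin 3)) =>
      lam N * ∫ ω : Metric.sphere (0 : EuclideanSpace ℝ (Fin 3)) 1,
        (let y := G.translate x (ε N • (ω : EuclideanSpace ℝ (Fin 3)));
          ∫ w : EuclideanSpace ℝ (Fin 3), max (inner ℝ (v - w) ω) 0 *
            Y (σ ^ 3 * ρ s (G.translate x ((ε N / 2) • (ω : EuclideanSpace ℝ (Fin 3))))) * f s y w *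
            (φ N s x (v - inner ℝ (v - w) ω • (ω : EuclideanSpace ℝ (Fin 3))) +
              φ N s y (w + inner ℝ (v - w) ω • (ω : EuclideanSpace ℝ (Fin 3))) - φ N s x v - φ N s y w))
        ∂Literature.MathematicalPhysics.KineticTheory.sphereMeasure
    let R := fun (N : ℕ) (z : Literature.Analysis.FluidPDE.Config (N + 1) (Fin 3) (UnitAddTorus (Fin 3))) =>
      (let q := fun r : ℝ => (Φ N).flow r z;
        (N + 1 : ℝ)⁻¹ * (∑ᶠ (s : ℝ) (_ : s ∈ Literature.Analysis.FluidPDE.collisionTimes G (ε N) q ∩ Set.Ioc 0 t),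
          ∑ i, ∑ j, (if i ≠ j ∧ ‖G.sepVec (q s i).1 (q s j).1‖ = ε N then
            φ N s (q s i).1 (q s i).2 -
              φ N s (q s i).1 (Literature.Analysis.FluidPDE.reflectVel (G.sepVec (q s i).1 (q s j).1)
                ((q s i).2, (q s j).2)).1 else 0)) -
        (∫ s in Set.Icc 0 t, ∫ y, L N s y.1 y.2 ∂(Literature.Analysis.FluidPDE.empiricalMeasure (q s))) +
        (1 / 2 : ℝ) * ∫ s in Set.Icc 0 t, ∫ x : UnitAddTorus (Fin 3), ∫ v : EuclideanSpace ℝ (Fin 3),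
          f s x v * L N s x v)
    (∀ N x v, φ N t x v = χ x * (a + inner ℝ b v + e * ‖v‖ ^ 2 / 2)) →
    (∃ η : ℕ → ℝ, Filter.Tendsto η Filter.atTop (nhds 0) ∧ ∃ Cg : ℝ, ∀ᶠ N in Filter.atTop,
      (∀ x v, ContDiffOn ℝ 1 (fun r => φ N r (G.translate x (r • v)) v) (Set.Icc 0 t)) ∧
      (∀ s ∈ Set.Icc 0 t, ∀ x v, ‖v‖ ≤ (N : ℝ) + 1 →
        |derivWithin (fun r => φ N r (G.translate x ((r - s) • v)) v)
          (Set.Icc 0 t) s + L N s x v| ≤ η N * (1 + ‖v‖ ^ 2)) ∧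
      (∀ s ∈ Set.Icc 0 t, ∀ x v, |derivWithin (fun r => φ N r (G.translate x ((r - s) • v)) v)
        (Set.Icc 0 t) s + L N s x v| ≤ Cg * (1 + ‖v‖ ^ 2) ^ 3)) →
    (∃ c₀ : UnitAddTorus (Fin 3) → ℝ × EuclideanSpace ℝ (Fin 3) × ℝ, Continuous c₀ ∧
      ∀ δ : ℝ, 0 < δ → ∀ᶠ N in Filter.atTop, ∀ x, dist (c N 0 x) (c₀ x) ≤ δ) →
    Filter.Tendsto (fun N : ℕ => (∫ x : UnitAddTorus (Fin 3), ∫ v : EuclideanSpace ℝ (Fin 3),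
        f t x v * φ N t x v) -
      (∫ x : UnitAddTorus (Fin 3), ∫ v : EuclideanSpace ℝ (Fin 3), f 0 x v * φ N 0 x v) -
      ∫ s in Set.Icc 0 t, ∫ x : UnitAddTorus (Fin 3), ∫ v : EuclideanSpace ℝ (Fin 3), f s x v *
        (derivWithin (fun r => φ N r (G.translate x ((r - s) • v)) v) (Set.Icc 0 t) s +
          (1 / 2 : ℝ) * L N s x v)) Filter.atTop (nhds 0) →
    Filter.Tendsto (fun N : ℕ => ∫⁻ z, ENNReal.ofReal (R N z ^ 2)
      ∂(Literature.MathematicalPhysics.KineticTheory.localGibbsLaw σ a₀ u₀ θ₀ N (Φ N)))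
      Filter.atTop (nhds 0) := by
  intro G₀ ε₀ lam f Y φ L R hterm hreg hc0 hResT
  obtain ⟨C, hadm⟩ := hadm
  obtain ⟨η, hη, Cg, hev⟩ := hreg
  obtain ⟨c₀, hc₀, hconv⟩ := hc0
  -- profiles on the window
  obtain ⟨hρc, huc, hθc, Rb, U, Θ, hρb, hub, hθb⟩ := eulerProfiles_window hEul ht.2
  have hρb' : ∀ s ∈ Icc 0 t, ∀ x, 0 ≤ ρ s x ∧ ρ s x ≤ Rb := fun s hs x =>
    ⟨(hρb s hs x).1.le, (hρb s hs x).2⟩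
  obtain ⟨hYc, Ybar, hYb⟩ := contactValue_window (t := t) hσ hA hρc (fun s hs x => (hρb s hs x).1) hguard
  obtain ⟨CG, hCG0, hCG⟩ := exists_integral_one_add_norm_sq_pow_gaussMeasure_le U Θ 4
  -- continuity and growth of the test functions
  have hφc : ∀ N, Continuous fun p : ℝ × T3 × V3 => φ N p.1 p.2.1 p.2.2 := by
    intro N
    have hcN : Continuous fun p : ℝ × T3 × V3 => c N p.1 p.2.1 :=
      (hc N).comp (continuous_fst.prodMk continuous_snd.fst)
    have h1c : Continuous fun p : ℝ × T3 × V3 => (c N p.1 p.2.1).1 := continuous_fst.comp hcN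
    have h21 : Continuous fun p : ℝ × T3 × V3 => (c N p.1 p.2.1).2.1 :=
      continuous_fst.comp (continuous_snd.comp hcN)
    have h22 : Continuous fun p : ℝ × T3 × V3 => (c N p.1 p.2.1).2.2 :=
      continuous_snd.comp (continuous_snd.comp hcN)
    show Continuous fun p : ℝ × T3 × V3 => (c N p.1 p.2.1).1 + ⟪(c N p.1 p.2.1).2.1, p.2.2⟫_ℝ +
      (c N p.1 p.2.1).2.2 * ‖p.2.2‖ ^ 2 / 2 + (lam N)⁻¹ * κ N p.1 p.2.1 p.2.2
    exact ((h1c.add (h21.inner continuous_snd.snd)).add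
      ((h22.mul (continuous_snd.snd.norm.pow 2)).div_const 2)).add (continuous_const.mul (hκ N))
  have hφb : ∀ N s x v, |φ N s x v| ≤ (3 * C + |(lam N)⁻¹| * C) * (1 + ‖v‖ ^ 2) := fun N s x v =>
    abs_testFn_le v (hadm N s x x v v).1 (hadm N s x x v v).2.2.1
  -- the test-side operator: growth and measurability, per `N`
  have hπc : Continuous fun s : ℝ => max 0 (min t s) :=
    continuous_const.max (continuous_const.min continuous_id)
  have hLfacts : ∀ N, ∃ K : ℝ, (∀ s ∈ Icc 0 t, ∀ x v, |L N s x v| ≤ K * (1 + ‖v‖ ^ 2) ^ 2) ∧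
      Measurable fun p : ℝ × T3 × V3 => L N (max 0 (min t p.1)) p.2.1 p.2.2 := by
    intro N
    obtain ⟨K, -, hK⟩ := abs_enskogL_le (t := t)
      (Yf := fun s x' => 3 / (2 * Real.pi) * deriv hsExcessFreeEnergy (σ ^ 3 * ρ s x'))
      (g := ρ) (θf := θ) (uf := u) (φ := φ N)
      (xs := fun x ω => G₀.translate x ((ε₀ N / 2) • (ω : V3)))
      (ys := fun x ω => G₀.translate x (ε₀ N • (ω : V3)))
      (Ybar := Ybar) (R := Rb) (U := U) (Θ := Θ) (Cφ := 3 * C + |(lam N)⁻¹| * C) (lam := lam N)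
      hYb hρb' hub hθb (fun s _ x v => hφb N s x v) (L N) (fun s x v => rfl)
    refine ⟨K, hK, ?_⟩
    have hsm1 : Continuous fun p : T3 × Metric.sphere (0 : V3) 1 => (ε₀ N / 2) • (p.2 : V3) := by
      fun_prop
    have hsm2 : Continuous fun p : T3 × Metric.sphere (0 : V3) 1 => ε₀ N • (p.2 : V3) := by
      fun_prop
    have hxs : Continuous (uncurry fun (x : T3) (ω : Metric.sphere (0 : V3) 1) =>
        G₀.translate x ((ε₀ N / 2) • (ω : V3))) := by
      show Continuous fun p : T3 × Metric.sphere (0 : V3) 1 => p.1 + Torus.proj ((ε₀ N / 2) • (p.2 : V3))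
      exact continuous_fst.add (Torus.continuous_proj.comp hsm1)
    have hys : Continuous (uncurry fun (x : T3) (ω : Metric.sphere (0 : V3) 1) =>
        G₀.translate x (ε₀ N • (ω : V3))) := by
      show Continuous fun p : T3 × Metric.sphere (0 : V3) 1 => p.1 + Torus.proj (ε₀ N • (p.2 : V3))
      exact continuous_fst.add (Torus.continuous_proj.comp hsm2)
    exact measurable_enskogL_of_continuous
      (Yf := fun s x' => 3 / (2 * Real.pi) * deriv hsExcessFreeEnergy (σ ^ 3 * ρ (max 0 (min t s)) x'))
      (g := fun s => ρ (max 0 (min t s))) (θf := fun s => θ (max 0 (min t s)))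
      (uf := fun s => u (max 0 (min t s))) (φ := fun s => φ N (max 0 (min t s)))
      (xs := fun x ω => G₀.translate x ((ε₀ N / 2) • (ω : V3)))
      (ys := fun x ω => G₀.translate x (ε₀ N • (ω : V3))) (lam := lam N)
      (continuous_frozen (g := fun s x' => 3 / (2 * Real.pi) * deriv hsExcessFreeEnergy (σ ^ 3 * ρ s x'))
        ht.1.le hYc) (continuous_frozen ht.1.le hρc) (continuous_frozen ht.1.le hθc)
      (fun s x => (hθb _ (clamp_mem_Icc ht.1.le s) x).1) (continuous_frozen ht.1.le huc)
      ((hφc N).comp ((hπc.comp continuous_fst).prodMk continuous_snd)) hxs hys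
      (fun s => L N (max 0 (min t s))) (fun s x v => rfl)
  -- the frozen Maxwellian weight is measurable
  have hfrozc : Continuous fun p : ℝ × T3 × V3 => f (max 0 (min t p.1)) p.2.1 p.2.2 := by
    have hq : Continuous fun p : ℝ × T3 × V3 => ((p.1, p.2.1) : ℝ × T3) :=
      continuous_fst.prodMk continuous_snd.fst
    have hρf := (continuous_frozen ht.1.le hρc).comp hq
    have hθf := (continuous_frozen ht.1.le hθc).comp hq
    have huf := (continuous_frozen ht.1.le huc).comp hq
    show Continuous fun p : ℝ × T3 × V3 => ρ (max 0 (min t p.1)) p.2.1 *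
      localMaxwellian 1 (θ (max 0 (min t p.1)) p.2.1) (u (max 0 (min t p.1)) p.2.1) p.2.2
    exact hρf.mul (continuous_localMaxwellian_param hθf
      (fun p => (hθb _ (clamp_mem_Icc ht.1.le p.1) p.2.1).1) huf continuous_snd.snd)
  -- the Euler side: `I₃ + ½ I₂ → 0`
  have hFbound : ∀ᶠ N in atTop, |(∫ s in Icc 0 t, ∫ x, ∫ v, f s x v *
        (derivWithin (fun r => φ N r ((Torus.geometry (Fin 3)).translate x ((r - s) • v)) v)
          (Icc 0 t) s + (1 / 2 : ℝ) * L N s x v)) +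
      (1 / 2 : ℝ) * ∫ s in Icc 0 t, ∫ x, ∫ v, f s x v * L N s x v| ≤
        (η N + Cg / ((N : ℝ) + 1) ^ 2) * (t * (Rb * CG)) := by
    filter_upwards [hev] with N hN
    obtain ⟨-, hdef, hdefg⟩ := hN
    obtain ⟨K, hKb, hKm⟩ := hLfacts N
    have hη0 : 0 ≤ η N := by
      have h := (abs_nonneg _).trans (hdef 0 ⟨le_rfl, ht.1.le⟩ 0 0 (by rw [norm_zero]; positivity))
      simpa using h
    have hV : (0 : ℝ) < (N : ℝ) + 1 := by positivity
    exact abs_I3_add_half_I2_le_cut ht.1 hρb' hub hθb hCG (f := f) (fun s x v => rfl)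
      (Φf := fun p => f (max 0 (min t p.1)) p.2.1 p.2.2) hfrozc.measurable
      (fun s hs x v => by simp only [clamp_eq_self hs])
      (fun s x v => derivWithin (fun r => φ N r ((Torus.geometry (Fin 3)).translate x ((r - s) • v)) v)
        (Icc 0 t) s) (L N)
      (Dm := fun p => deriv (fun r => φ N r ((Torus.geometry (Fin 3)).translate p.2.1
        ((r - p.1) • p.2.2)) p.2.2) p.1)
      (Lm := fun p => L N (max 0 (min t p.1)) p.2.1 p.2.2) (measurable_charDeriv (hφc N)) hKm
      (fun s hs x v => derivWithin_charDeriv_eq_deriv hs x v)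
      (fun s hs x v => by simp only [clamp_eq_self hs]) hKb hη0 hV hdef hdefg
  have hF : Tendsto (fun N => (∫ s in Icc 0 t, ∫ x, ∫ v, f s x v *
        (derivWithin (fun r => φ N r ((Torus.geometry (Fin 3)).translate x ((r - s) • v)) v)
          (Icc 0 t) s + (1 / 2 : ℝ) * L N s x v)) +
      (1 / 2 : ℝ) * ∫ s in Icc 0 t, ∫ x, ∫ v, f s x v * L N s x v) atTop (𝓝 0) := by
    refine squeeze_zero_norm' (a := fun N => (η N + Cg / ((N : ℝ) + 1) ^ 2) * (t * (Rb * CG)))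
      (hFbound.mono fun N h => ?_) ?_
    · rw [Real.norm_eq_abs]; exact h
    · have h1 : Tendsto (fun N : ℕ => Cg / ((N : ℝ) + 1) ^ 2) atTop (𝓝 0) := by
        have h2 : Tendsto (fun N : ℕ => ((N : ℝ) + 1) ^ 2) atTop atTop :=
          (tendsto_pow_atTop two_ne_zero).comp
            (tendsto_natCast_atTop_atTop.atTop_add tendsto_const_nhds)
        exact h2.const_div_atTop Cg
      simpa using (hη.add h1).mul_const (t * (Rb * CG))
  -- the initial term
  have hlamInv : Tendsto (fun N => (lam N)⁻¹) atTop (𝓝 0) := by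
    show Tendsto (fun N : ℕ => ((N : ℝ) * hsDiameter σ N ^ 2)⁻¹) atTop (𝓝 0)
    exact tendsto_lamInv_zero hσ
  have h0mem : (0 : ℝ) ∈ Icc 0 t := ⟨le_rfl, ht.1.le⟩
  have hρ0c : Continuous (ρ 0) :=
    hρc.comp_continuous (continuous_const.prodMk continuous_id) fun x => ⟨h0mem, mem_univ x⟩
  have hu0c : Continuous (u 0) :=
    huc.comp_continuous (continuous_const.prodMk continuous_id) fun x => ⟨h0mem, mem_univ x⟩
  have hθ0c : Continuous (θ 0) :=
    hθc.comp_continuous (continuous_const.prodMk continuous_id) fun x => ⟨h0mem, mem_univ x⟩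
  have h0 := initial_term_tendsto ha hθ hu ha0 hθ0 hσhalf Φ hLLN hρ0c hu0c hθ0c
    (fun x => (hθb 0 h0mem x).1) (fun x => (hρb 0 h0mem x).1.le) c κ hc hκ (C := C)
    (fun N s x v => ⟨(hadm N s x x v v).1, (hadm N s x x v v).2.2.1⟩) (fun N => (lam N)⁻¹) hlamInv
    hc₀ hconv φ (fun N s x v => rfl) f (fun s x v => rfl)
  -- the time-`t` term: the hydrodynamic limit at time `t`, made `L²` and identified
  have htmem : t ∈ Icc 0 t := ⟨ht.1.le, le_rfl⟩
  have hρtc : Continuous (ρ t) :=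
    hρc.comp_continuous (continuous_const.prodMk continuous_id) fun x => ⟨htmem, mem_univ x⟩
  have hutc : Continuous (u t) :=
    huc.comp_continuous (continuous_const.prodMk continuous_id) fun x => ⟨htmem, mem_univ x⟩
  have hθtc : Continuous (θ t) :=
    hθc.comp_continuous (continuous_const.prodMk continuous_id) fun x => ⟨htmem, mem_univ x⟩
  have hcombo := tendsto_lintegral_sq_hydroCombo_of_tendstoHydroFieldsAt ha hθ hu ha0 hθ0 hσhalf Φ
    hHyd hχ a e b
  have hAeq : ∀ N (w : Config (N + 1) (Fin 3) T3),
      ((N : ℝ) + 1)⁻¹ * (∑ i, φ N t (w i).1 (w i).2) =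
        a * empiricalDensityField w χ + ⟪b, empiricalMomentumField w χ⟫_ℝ +
          e * empiricalEnergyField w χ := by
    intro N w
    rw [← avg_chi_affine_eq_combo w χ a e b]
    congr 1
    exact Finset.sum_congr rfl fun i _ => hterm N _ _
  have hBeq : ∀ N, (∫ x, ∫ v, f t x v * φ N t x v) =
      a * (∫ x, χ x * ρ t x) + ⟪b, ∫ x, (χ x * ρ t x) • u t x⟫_ℝ +
        e * ∫ x, χ x * totalEnergyDensity (ρ t x) (u t x) (θ t x) := by
    intro N
    rw [← integral_ft_chi_affine_eq_combo hρtc hutc hθtc (fun x => (hθb t htmem x).1) hχ a e b]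
    refine integral_congr_ae (Eventually.of_forall fun x => integral_congr_ae
      (Eventually.of_forall fun v => ?_))
    show f t x v * φ N t x v = _
    rw [hterm]
  have hAt : Tendsto (fun N => ∫⁻ z, ENNReal.ofReal
      ((((N : ℝ) + 1)⁻¹ * (∑ i, φ N t ((Φ N).flow t z i).1 ((Φ N).flow t z i).2) -
        ∫ x, ∫ v, f t x v * φ N t x v) ^ 2)
      ∂localGibbsLaw σ a₀ u₀ θ₀ N (Φ N)) atTop (𝓝 0) := by
    refine hcombo.congr fun N => lintegral_congr fun z => ?_
    have hid : a * (empiricalDensityField ((Φ N).flow t z) χ - ∫ x, χ x * ρ t x) +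
        ⟪b, empiricalMomentumField ((Φ N).flow t z) χ - ∫ x, (χ x * ρ t x) • u t x⟫_ℝ +
        e * (empiricalEnergyField ((Φ N).flow t z) χ -
          ∫ x, χ x * totalEnergyDensity (ρ t x) (u t x) (θ t x)) =
        ((N : ℝ) + 1)⁻¹ * (∑ i, φ N t ((Φ N).flow t z i).1 ((Φ N).flow t z i).2) -
          ∫ x, ∫ v, f t x v * φ N t x v := by
      rw [hAeq N ((Φ N).flow t z), hBeq N, inner_sub_right]
      ring
    rw [hid]
  -- the assembly, read from left to right
  exact residual_assembly_cut ha hθ hu ha0 hθ0 hσhalf Φ ht.1 φ L f R hφc ⟨η, hη, Cg, hev⟩ hLfacts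
    (fun N z => rfl) hAt hResT hF h0

/-- **Registered form** (sub-goal `cutoff_converse_duality` of the crux stmt-AtomisticToContinuum-14658, line `birth`): `collisionResidual_tendsto_zero_of_tendstoHydroFieldsAt_cut` as a closed `∀`-statement — the hydrodynamic limit at time `t` implies that the collision residual of K1 vanishes in mean square on every admissible family that is approximately dual BELOW THE VELOCITY CUTOFF `‖v‖ ≤ N+1` (plus a global polynomial defect bound). [cite: PulvirentiSimonella2016, §2] -/
theorem cutoff_converse_duality : ∀ {a₀ θ₀ : T3 → ℝ} {u₀ : T3 → V3} {η₁ : ℝ} (hA : AnalyticOnNhd ℝ hsExcessFreeEnergy (Ioo 0 η₁)) (ha : Continuous a₀) (hθ : Continuous θ₀) (hu : Continuous u₀) (ha0 : ∀ x, 0 < a₀ x) (hθ0 : ∀ x, 0 < θ₀ x) {σ : ℝ} (hσ : 0 < σ) (hσhalf : σ ≤ 1 / 2) {T : ℝ} {ρ θ : ℝ → T3 → ℝ} {u : ℝ → T3 → V3} (hEul : IsHardSphereEulerSolution σ T ρ u θ) (Φ : (N : ℕ) → HardSphereFlow (Torus.geometry (Fin 3)) (hsDiameter σ N) (N + 1))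 (hLLN : TendstoHydroFieldsAt (fun N => localGibbsLaw σ a₀ u₀ θ₀ N (Φ N)) Φ ρ u θ 0) {t : ℝ} (ht : t ∈ Ioo 0 T) (hguard : ∀ s ∈ Icc 0 t, ∀ x, ρ s x * σ ^ 3 < η₁) (hHyd : TendstoHydroFieldsAt (fun N => localGibbsLaw σ a₀ u₀ θ₀ N (Φ N)) Φ ρ u θ t) {χ : T3 → ℝ} (hχ : Continuous χ) (a e : ℝ) (b : V3) (c : ℕ → ℝ → T3 → ℝ × V3 × ℝ) (κ : ℕ → ℝ → T3 → V3 → ℝ) (hc : ∀ N, Continuous (uncurry (c N))) (hκ : ∀ N, Continuous (fun p : ℝ × T3 × V3 => κ N p.1 p.2.1 p.2.2)) (hadm : ∃ C : ℝ, ∀ N s x x' v v', ‖c N s x‖ ≤ C ∧ dist (c N s x) (c N s x') ≤ C * dist x x' ∧ |κ N s x v| ≤ C * (1 + ‖v‖ ^ 2) ∧ |κ N s x v - κ N s x' v'| ≤ C * (1 + ‖v‖ ^ 2 + ‖v'‖ ^ 2) * (dist x x' + ‖v - v'‖)), let G := Torus.geometry (Fin 3); let ε := fun N : ℕ => hsDiameter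 σ N; let lam := fun N : ℕ => (N : ℝ) * ε N ^ 2; let f := fun (s : ℝ) (x : T3) (v : V3) => ρ s x * localMaxwellian 1 (θ s x) (u s x) v; let Y := fun η : ℝ => 3 / (2 * Real.pi) * deriv hsExcessFreeEnergy η; let φ := fun (N : ℕ) (s : ℝ) (x : T3) (v : V3) => (c N s x).1 + inner ℝ (c N s x).2.1 v + (c N s x).2.2 * ‖v‖ ^ 2 / 2 + (lam N)⁻¹ * κ N s x v; let L := fun (N : ℕ) (s : ℝ) (x : T3) (v : V3) => lam N * ∫ ω : Metric.sphere (0 : V3) 1, (let y := G.translate x (ε N • (ω : V3)); ∫ w : V3, max (inner ℝ (v - w) ω) 0 * Y (σ ^ 3 * ρ s (G.translate x ((ε N / 2) • (ω : V3)))) * f s y w * (φ N s x (v - inner ℝ (v - w) ω • (ω : V3)) + φ N s y (w + inner ℝ (v - w) ω • (ω : V3)) - φ N s x v - φ N s y w)) ∂sphereMeasure; let R := fun (N : ℕ) (z : Config (N + 1) (Fin 3) (T3)) => (let q := fun r : ℝ => (Φ N).flow r z; (N + 1 : ℝ)⁻¹ * (∑ᶠ (s : ℝ) (_ : s ∈ collisionTimes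 G (ε N) q ∩ Ioc 0 t), ∑ i, ∑ j, (if i ≠ j ∧ ‖G.sepVec (q s i).1 (q s j).1‖ = ε N then φ N s (q s i).1 (q s i).2 - φ N s (q s i).1 (reflectVel (G.sepVec (q s i).1 (q s j).1) ((q s i).2, (q s j).2)).1 else 0)) - (∫ s in Icc 0 t, ∫ y, L N s y.1 y.2 ∂(empiricalMeasure (q s))) + (1 / 2 : ℝ) * ∫ s in Icc 0 t, ∫ x : T3, ∫ v : V3, f s x v * L N s x v); (∀ N x v, φ N t x v = χ x * (a + inner ℝ b v + e * ‖v‖ ^ 2 / 2)) → (∃ η : ℕ → ℝ, Tendsto η atTop (𝓝 0) ∧ ∃ Cg : ℝ, ∀ᶠ N in atTop, (∀ x v, ContDiffOn ℝ 1 (fun r => φ N r (G.translate x (r • v)) v) (Icc 0 t)) ∧ (∀ s ∈ Icc 0 t, ∀ x v, ‖v‖ ≤ (N : ℝ) + 1 → |derivWithin (fun r => φ N r (G.translate x ((r - s) • v)) v) (Icc 0 t) s + L N s x v| ≤ η N * (1 + ‖v‖ ^ 2)) ∧ (∀ s ∈ Icc 0 t, ∀ x v, |derivWithin (fun r => φ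 N r (G.translate x ((r - s) • v)) v) (Icc 0 t) s + L N s x v| ≤ Cg * (1 + ‖v‖ ^ 2) ^ 3)) → (∃ c₀ : T3 → ℝ × V3 × ℝ, Continuous c₀ ∧ ∀ δ : ℝ, 0 < δ → ∀ᶠ N in atTop, ∀ x, dist (c N 0 x) (c₀ x) ≤ δ) → Tendsto (fun N : ℕ => (∫ x : T3, ∫ v : V3, f t x v * φ N t x v) - (∫ x : T3, ∫ v : V3, f 0 x v * φ N 0 x v) - ∫ s in Icc 0 t, ∫ x : T3, ∫ v : V3, f s x v * (derivWithin (fun r => φ N r (G.translate x ((r - s) • v)) v) (Icc 0 t) s + (1 / 2 : ℝ) * L N s x v)) atTop (𝓝 0) → Tendsto (fun N : ℕ => ∫⁻ z, ENNReal.ofReal (R N z ^ 2) ∂(localGibbsLaw σ a₀ u₀ θ₀ N (Φ N))) atTop (𝓝 0) :=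
  @collisionResidual_tendsto_zero_of_tendstoHydroFieldsAt_cut

end Summit.AtomisticToContinuum.HydrodynamicLimit.Theorems

end
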